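import Mathlib
import HarnessLib
import Literature.MathematicalPhysics.QuantumLattice.GrassmannSourceGradedStep
import Summits.HubbardSuperconductivity.HubbardSuperconductivity.Theorems.KLProgrammeKLRegimeTwoVolumeTowerTruncDefs

/-!
# Route `KLProgramme` — crux K3, VL child `KLRegimeVolumeLimitV17F2` (stmt-HubbardSuperconductivity-20440), blueprint v5 M5: THE SOURCE-RESCALED,
# SOURCE-TRUNCATED DATA PACKAGE (definitions; located «SRC-DEG2», cure (β) of plan g22 (R171); seat hubbard-kl-k3c4-p1 g15; `--supports` 20440;
# definition lane)

Located «SRC-DEG2» (memo SRC-DEG2-g14, `…TowerScaleSmallNecessary.TowerDataT.exp_five_mul_aW_mul_nv_one_lt`): the DEFINITION-FROZEN smallness (H3) of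
`…TowerTruncDefs.TowerDataT` bounds the degree-2 budget of EVERY source family radii-free, while the producer text of skeleton «cauchy» v10 leaves the
one- and two-source-leg families free.  The cure of record ([BGM06] §2.9 (4.6)–(4.8): the sources are dead variables and may be RESCALED) runs the nested
two-volume induction on the source-rescaled states `S_t X`, `S_t = ExteriorAlgebra.map (mulLeft c_t)`, `c_t = t` on the source copy `1` and `1` on the alive
copy `0` (Literature `GrassmannSourceGradedStep`): kernels scale by `t^{#source legs}`, so the budgets become `S₀ + t·S₁ + t²·S₂` and (H3) follows from the
alive law alone for `t` small (volume-free); `S_t` commutes with the spectator steps, the copy-diagonal transfers and the source truncation, and the END reads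
the two-source-leg keyed defect of the unscaled states back as `t⁻² ×` that of the scaled ones.  This file NAMES the corresponding objects:

* `TwoVolumeDefect.srcScale 𝕜 t` — the source rescaling on doubled labels `Γ × Fin 2` (generic); `kernel_srcScale`, `srcScale_one`;
* `klTowerDS L M β U μ K t k := srcScale ℂ t (klTowerD … k)`, `klTowerStateS L M β U μ K t j` (the rescaled read-outs and states, same recursion shape as
  `klTowerState`: `_zero`/`_succ` by `rfl`), `klTowerDS_one`, `klTowerStateS_one`;
* `klKeyedDefectTS L b M β U μ Kc Kf t j k p w` — the keyed two-volume defect of the SOURCE-TRUNCATED RESCALED states; `_eq`, `_nonneg`, `_one`;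
* **`TowerVolumeDataTS`** — `TowerVolumeDataT` with the profile field on `srcTrunc 3 (klTowerDS … t j)`; **`TowerDataTS β U μ t`** — `TowerDataT β U μ` with
  `TowerVolumeDataTS … t` in (H5) and the base (H6) on the rescaled truncated step-`0` states (everything else byte-identical);
  `TowerVolumeDataT.scaleOne`, `TowerDataT.scaleOne : TowerDataT β U μ → TowerDataTS β U μ 1`, `nonempty_towerDataTS_one_of_towerDataT` (t = 1 is the v10 package:
  nothing a v10 discharger proves is lost).

Definitions (with bodies) and their trivial unfoldings only; the commutation identities and the scaling inequalities are `…TowerSrcScaledKit`; nothing about the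
model is asserted. [cite: BenfattoGiulianiMastropietro2006, §2.9 (4.6)-(4.8)]
-/

noncomputable section

namespace Summit.HubbardSuperconductivity.HubbardSuperconductivity.Theorems.TwoVolumeDefect

set_option linter.dupNamespace false -- summit = problem name (single-conjunct summit), D-0017

open Finset Literature.MathematicalPhysics.QuantumLattice GrassmannAlgebra

/-! ## §1 The source rescaling on doubled labels (generic) -/

section Generic

variable (𝕜 : Type*) [RCLike 𝕜] {Γ : Type*}

/-- **`srcScale 𝕜 t`** — the BGM §2.9 source rescaling on the doubled labels `Γ × Fin 2`: the substitution multiplying every source leg (copy `1`) by `t`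
and fixing the alive legs (copy `0`). [cite: BenfattoGiulianiMastropietro2006, §2.9 (4.6)-(4.8)] -/
def srcScale (t : ℝ) : GrassmannAlgebra 𝕜 (Γ × Fin 2) →ₐ[𝕜] GrassmannAlgebra 𝕜 (Γ × Fin 2) :=
  ExteriorAlgebra.map (LinearMap.mulLeft 𝕜 (fun Y : Γ × Fin 2 => if Y.2 = 1 then ((t : ℝ) : 𝕜) else 1))

/-- Unfolding `srcScale` to the Literature form `ExteriorAlgebra.map (mulLeft c_t)`. [folklore] -/
theorem srcScale_apply (t : ℝ) (F : GrassmannAlgebra 𝕜 (Γ × Fin 2)) :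
    srcScale 𝕜 t F = ExteriorAlgebra.map (LinearMap.mulLeft 𝕜 (fun Y : Γ × Fin 2 => if (fun p : Γ × Fin 2 => p.2 = 1) Y then ((t : ℝ) : 𝕜) else 1)) F := rfl

/-- **Kernels of the rescaled element**: `kernel (S_t F) m X = t^{#source legs of X} · kernel F m X`. [cite: BenfattoGiulianiMastropietro2006, §2.9 (4.6)-(4.8)] -/
theorem kernel_srcScale [Fintype Γ] [DecidableEq Γ] (t : ℝ) (F : GrassmannAlgebra 𝕜 (Γ × Fin 2)) (m : ℕ) (X : Fin m → Γ × Fin 2) :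
    kernel 𝕜 (srcScale 𝕜 t F) m X = ((t : ℝ) : 𝕜) ^ srcCount (fun p : Γ × Fin 2 => p.2 = 1) X * kernel 𝕜 F m X := by
  rw [srcScale_apply]
  exact kernel_map_mulLeft_srcWeight 𝕜 (fun p : Γ × Fin 2 => p.2 = 1) ((t : ℝ) : 𝕜) F m X

/-- `S_1 = id`. [folklore] -/
theorem srcScale_one [Fintype Γ] [DecidableEq Γ] (F : GrassmannAlgebra 𝕜 (Γ × Fin 2)) : srcScale 𝕜 1 F = F :=
  grassmann_eq_of_kernel_eq fun m X => by rw [kernel_srcScale, RCLike.ofReal_one, one_pow, one_mul]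

end Generic

end Summit.HubbardSuperconductivity.HubbardSuperconductivity.Theorems.TwoVolumeDefect

namespace Summit.HubbardSuperconductivity.HubbardSuperconductivity.Theorems.TwoVolumeSource

set_option linter.dupNamespace false -- summit = problem name (single-conjunct summit), D-0017

open Finset Filter Topology Literature.MathematicalPhysics.QuantumLattice GrassmannAlgebra Literature.Probability.LatticeModels
  Literature.Probability.LatticeModels.BattleFederbush
open Summit.HubbardSuperconductivity.HubbardSuperconductivity.Theorems.TwoPointAssembly
open Summit.HubbardSuperconductivity.HubbardSuperconductivity.Theorems.KLRegimeSplit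
open Summit.HubbardSuperconductivity.HubbardSuperconductivity.Theorems.KLProgrammeLegKernels
open Summit.HubbardSuperconductivity.HubbardSuperconductivity.Theorems.EngineV8
open Summit.HubbardSuperconductivity.HubbardSuperconductivity.Theorems.TwoVolumeDefect

/-! ## §2 The rescaled read-outs and states of the tower -/

section Tower

variable (L M : ℕ) [NeZero L] [NeZero M]

/-- **`S_t D_{k+1}`**: the source-rescaled doubled read-out of scale `k+1` analysed at level `k`. [cite: BenfattoGiulianiMastropietro2006, §2.9 (4.6)-(4.8)] -/
def klTowerDS (β U μ : ℝ) (K : TrigPolyC4v) (t : ℝ) (k : ℕ) : GrassmannAlgebra ℂ (SrcLabel L M k) :=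
  srcScale ℂ t (klTowerD L M β U μ K k)

/-- **The source-rescaled state of the induction at step `j`** (same recursion shape as `klTowerState`): `S_t D_1` at `j = 0`,
`effAction C⁺_k (S_t D_{k+1})` at `j = k+1`. [cite: BenfattoGiulianiMastropietro2006, §2.9 (4.6)-(4.8)] -/
def klTowerStateS (β U μ : ℝ) (K : TrigPolyC4v) (t : ℝ) : (j : ℕ) → GrassmannAlgebra ℂ (SrcLabel L M (j - 1))
  | 0 => klTowerDS L M β U μ K t 0
  | k + 1 => effAction ℂ (klStepCovD L M β μ K k) (klTowerDS L M β U μ K t k)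

variable {L M}

omit [NeZero M] in
/-- Unfolding `klTowerDS`. [folklore] -/
theorem klTowerDS_eq (β U μ : ℝ) (K : TrigPolyC4v) (t : ℝ) (k : ℕ) : klTowerDS L M β U μ K t k = srcScale ℂ t (klTowerD L M β U μ K k) := rfl

omit [NeZero M] in
/-- The rescaled state at step `0` is `S_t D_1`. [folklore] -/
theorem klTowerStateS_zero (β U μ : ℝ) (K : TrigPolyC4v) (t : ℝ) : klTowerStateS L M β U μ K t 0 = klTowerDS L M β U μ K t 0 := rfl

omit [NeZero M] in
/-- The rescaled state at step `k+1` is `effAction C⁺_k (S_t D_{k+1})`. [folklore] -/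
theorem klTowerStateS_succ (β U μ : ℝ) (K : TrigPolyC4v) (t : ℝ) (k : ℕ) :
    klTowerStateS L M β U μ K t (k + 1) = effAction ℂ (klStepCovD L M β μ K k) (klTowerDS L M β U μ K t k) := rfl

omit [NeZero M] in
/-- At `t = 1` the rescaled read-out is the read-out. [folklore] -/
theorem klTowerDS_one (β U μ : ℝ) (K : TrigPolyC4v) (k : ℕ) : klTowerDS L M β U μ K 1 k = klTowerD L M β U μ K k :=
  srcScale_one ℂ _

omit [NeZero M] in
/-- At `t = 1` the rescaled state is the state. [folklore] -/
theorem klTowerStateS_one (β U μ : ℝ) (K : TrigPolyC4v) (j : ℕ) : klTowerStateS L M β U μ K 1 j = klTowerState L M β U μ K j := by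
  cases j with
  | zero => exact klTowerDS_one β U μ K 0
  | succ k => rw [klTowerStateS_succ, klTowerState_succ, klTowerDS_one]

end Tower

/-! ## §3 The keyed defect of the source-truncated rescaled states -/

section Defect

variable (L b M : ℕ) [NeZero L] [NeZero (b * L)]

/-- **The keyed two-volume defect of the SOURCE-TRUNCATED RESCALED tower states** at step `j`, raw degree `k`, pin slot `p`, fine pin `w` (same key as
`klKeyedDefectT`, states replaced by `srcTrunc 3 (klTowerStateS … t j)`). [cite: BenfattoGiulianiMastropietro2006, §2.9 (4.3)-(4.8)] -/
def klKeyedDefectTS (β U μ : ℝ) (Kc Kf : TrigPolyC4v) (t : ℝ) (j k : ℕ) (p : Fin k) (w : SrcLabel (b * L) M (j - 1)) : ℝ :=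
  ∑ X ∈ univ.filter (fun X : Fin k → SrcLabel (b * L) M (j - 1) => X p = w),
    ‖kernel ℂ (srcTrunc ℂ (fun q : SrcLabel (b * L) M (j - 1) => q.2 = 1) 3 (klTowerStateS (b * L) M β U μ Kf t j)) k X -
      (if ∀ i, (klBlockEquivD L b M (j - 1) (X i)).1 = (klBlockEquivD L b M (j - 1) (X p)).1 then
        kernel ℂ (srcTrunc ℂ (fun q : SrcLabel L M (j - 1) => q.2 = 1) 3 (klTowerStateS L M β U μ Kc t j)) k
          (fun i => (klBlockEquivD L b M (j - 1) (X i)).2) else 0)‖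

variable {L b M}

/-- Unfolding `klKeyedDefectTS`. [folklore] -/
theorem klKeyedDefectTS_eq (β U μ : ℝ) (Kc Kf : TrigPolyC4v) (t : ℝ) (j k : ℕ) (p : Fin k) (w : SrcLabel (b * L) M (j - 1)) :
    klKeyedDefectTS L b M β U μ Kc Kf t j k p w =
      ∑ X ∈ univ.filter (fun X : Fin k → SrcLabel (b * L) M (j - 1) => X p = w),
        ‖kernel ℂ (srcTrunc ℂ (fun q : SrcLabel (b * L) M (j - 1) => q.2 = 1) 3 (klTowerStateS (b * L) M β U μ Kf t j)) k X -
          (if ∀ i, (klBlockEquivD L b M (j - 1) (X i)).1 = (klBlockEquivD L b M (j - 1) (X p)).1 then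
            kernel ℂ (srcTrunc ℂ (fun q : SrcLabel L M (j - 1) => q.2 = 1) 3 (klTowerStateS L M β U μ Kc t j)) k
              (fun i => (klBlockEquivD L b M (j - 1) (X i)).2) else 0)‖ := rfl

/-- The rescaled truncated keyed defect is nonnegative. [folklore] -/
theorem klKeyedDefectTS_nonneg (β U μ : ℝ) (Kc Kf : TrigPolyC4v) (t : ℝ) (j k : ℕ) (p : Fin k) (w : SrcLabel (b * L) M (j - 1)) :
    0 ≤ klKeyedDefectTS L b M β U μ Kc Kf t j k p w :=
  sum_nonneg fun _ _ => norm_nonneg _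

/-- At `t = 1` the rescaled truncated keyed defect is the truncated keyed defect. [folklore] -/
theorem klKeyedDefectTS_one [NeZero M] (β U μ : ℝ) (Kc Kf : TrigPolyC4v) (j k : ℕ) (p : Fin k) (w : SrcLabel (b * L) M (j - 1)) :
    klKeyedDefectTS L b M β U μ Kc Kf 1 j k p w = klKeyedDefectT L b M β U μ Kc Kf j k p w := by
  rw [klKeyedDefectTS_eq, klKeyedDefectT_eq, klTowerStateS_one, klTowerStateS_one]

end Defect

/-! ## §4 The source-truncated rescaled one-volume bundle -/

/-- **`TowerVolumeDataTS V M β U μ K J ε t Λ κ aW sW NV`** — `TowerVolumeDataT` with E1's even weighted profiles asked of the SOURCE-TRUNCATED RESCALED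
read-outs `srcTrunc 3 (klTowerDS V … K t j)` (budgets `S₀ + t·S₁ + t²·S₂` of the unscaled source families). -/
structure TowerVolumeDataTS (V M : ℕ) [NeZero V] (β U μ : ℝ) (K : TrigPolyC4v) (J : ℕ) (ε t : ℝ) (Λ κ aW sW : ℕ → ℝ) (NV : ℕ → ℕ → ℝ) : Prop where
  /-- partition functions of the integrated scales -/
  Z : ∀ k, k + 1 ≤ J → hubbardEffPartitionFnCT V M β U μ 0 K (klScale klE0 (k + 1)) ≠ 0
  /-- parity of the (unscaled) read-outs -/
  parity : ∀ j, j ≤ J → klTowerD V M β U μ K j ∈ evenOdd ℂ 0 ∧ constPart ℂ (klTowerD V M β U μ K j) = 0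
  /-- step-covariance bundles -/
  cov : ∀ j, j < J → ScaleCovData (klStepCov V M β μ K j) (Λ j) (κ j) (aW j / ε) (sW j)
  /-- E1's even weighted profiles (normalised) of the SOURCE-TRUNCATED RESCALED read-outs -/
  profile : ∀ j, j ≤ J → WtProfileEven (srcTrunc ℂ (fun q : SrcLabel V M j => q.2 = 1) 3 (klTowerDS V M β U μ K t j)) (Λ j) (fun m => ε * NV j m)

/-- The truncated bundle is the rescaled truncated bundle at `t = 1`. [folklore] -/
theorem TowerVolumeDataT.scaleOne {V M : ℕ} [NeZero V] [NeZero M] {β U μ : ℝ} {K : TrigPolyC4v} {J : ℕ} {ε : ℝ} {Λ κ aW sW : ℕ → ℝ}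
    {NV : ℕ → ℕ → ℝ} (h : TowerVolumeDataT V M β U μ K J ε Λ κ aW sW NV) : TowerVolumeDataTS V M β U μ K J ε 1 Λ κ aW sW NV where
  Z := h.Z
  parity := h.parity
  cov := h.cov
  profile j hj := by rw [klTowerDS_one]; exact h.profile j hj

/-! ## §5 The source-truncated rescaled data package -/

/-- **`TowerDataTS β U μ t`** — `TowerDataT β U μ` at source scale `t`: the one-volume bundles are `TowerVolumeDataTS … t` and the base (H6) is the keyed
defect of the SOURCE-TRUNCATED RESCALED step-`0` states (everything else byte-identical: constants, (H1)–(H4), `TowerCrossData`). -/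
structure TowerDataTS (β U μ t : ℝ) where
  /-- Matsubara-cutoff threshold of an admissible instance `(L, b, M)`: `Mth L b ≤ M` -/
  Mth : ℕ → ℕ → ℕ
  /-- the depth schedule `r_L → ∞` with `2·(2(J+1)·r_L + r_L) < L`, `J = nScales β` -/
  r : ℕ → ℕ
  hr : Tendsto r atTop atTop
  hRd : ∀ L, 0 < L → 2 * (2 * (nScales β + 1) * r L + r L) < L
  /-- volume-free constants per scale -/
  Λ : ℕ → ℝ
  κ : ℕ → ℝ
  aW : ℕ → ℝ
  sW : ℕ → ℝ
  κ' : ℕ → ℝ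
  aW' : ℕ → ℝ
  sW' : ℕ → ℝ
  eW' : ℕ → ℝ
  ΛT : ℕ → ℝ
  cW : ℕ → ℝ
  κf : ℕ → ℝ
  cRb : ℕ → ℝ
  cCb : ℕ → ℝ
  δb : ℕ → ℝ
  ρ₀ : ℕ → ℝ
  ρf : ℕ → ℝ
  ρ₂ : ℕ → ℝ
  ρ' : ℕ → ℝ
  ρ₃ : ℕ → ℝ
  ν₀ : ℕ → ℝ
  ν₁ : ℕ → ℝ
  ν₂ : ℕ → ℝ
  ν₃ : ℕ → ℝ
  ν₄ : ℕ → ℝ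
  ν₅ : ℕ → ℝ
  νE : ℕ → ℝ
  ν₆ : ℕ → ℝ
  ν₇ : ℕ → ℝ
  ν₈ : ℕ → ℝ
  /-- E1's L-free even budgets `NV j m` (of the rescaled read-outs) and the raw budgets `NS j k` of the rescaled states -/
  NV : ℕ → ℕ → ℝ
  NS : ℕ → ℕ → ℝ
  /-- the frame-mismatch rates (scale `j`, coarse volume `L`) -/
  sE : ℕ → ℕ → ℝ
  cR : ℕ → ℕ → ℝ
  cC : ℕ → ℕ → ℝ
  δ : ℕ → ℕ → ℝ
  /-- (H1) signs -/
  hΛ : ∀ j, 0 < Λ j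
  hΛmono : ∀ j, Λ (j + 1) ≤ Λ j
  hΛT : ∀ j, Λ j ≤ ΛT j
  hκ : ∀ j, 0 < κ j ∧ 0 < κ' j ∧ 0 < κf j
  haW : ∀ j, 0 ≤ aW j ∧ 0 ≤ aW' j ∧ 0 ≤ sW j ∧ 0 ≤ sW' j ∧ 0 ≤ eW' j ∧ 0 ≤ cW j ∧ 0 ≤ δb j
  hρ : ∀ j, 0 < ρ₀ j ∧ 0 < ρf j ∧ 0 < ρ₂ j ∧ 0 < ρ' j ∧ 0 < ρ₃ j
  hNV0 : ∀ j m, 0 ≤ NV j m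
  hNSnn : ∀ j k, 0 ≤ NS j k
  /-- (H2) the raw-budget recursion -/
  hNS0 : ∀ k, NS 0 k = if Even k then NV 0 (k / 2) else 0
  hNSsucc : ∀ j k, j < nScales β → NS (j + 1) k = (ρ₀ j)⁻¹ ^ k * (Real.exp 1 * ν₀ j) / (1 - Real.exp 1 * aW j * ν₀ j / κ j ^ 2)
  /-- (H3) volume-free smallness of every step -/
  hsm : ∀ j, j < nScales β → TowerScaleSmall (κ j) (κ' j) (aW j) (aW' j) (cW j) (κf j) (cRb j) (cCb j) (δb j) (ρ₀ j) (ρf j) (ρ₂ j) (ρ' j) (ρ₃ j) (NV j) (NS j)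
    (ν₀ j) (ν₁ j) (ν₂ j) (ν₃ j) (ν₄ j) (ν₅ j) (νE j) (ν₆ j) (ν₇ j) (ν₈ j)
  /-- (H4) the mismatch rates: signs, caps, limits -/
  hmis : ∀ j L, 0 ≤ sE j L ∧ 0 ≤ cR j L ∧ 0 ≤ cC j L ∧ 0 ≤ δ j L ∧ cR j L ≤ cRb j ∧ cC j L ≤ cCb j ∧ δ j L ≤ δb j
  hmis0 : ∀ j, Tendsto (sE j) atTop (𝓝 0) ∧ Tendsto (cR j) atTop (𝓝 0) ∧ Tendsto (cC j) atTop (𝓝 0) ∧ Tendsto (δ j) atTop (𝓝 0)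
  /-- (H5) the three data bundles (one-volume bundles SOURCE-TRUNCATED and RESCALED by `t`), eventually in `L`, at every admissible instance, at the flow frames -/
  hdata : ∀ᶠ L in atTop, ∀ (b M : ℕ) [NeZero L] [NeZero (b * L)] [NeZero M], Mth L b ≤ M →
    TowerVolumeDataTS L M β U μ (klFlowFrameU L M β U μ (nScales β + 1)) (nScales β) (imagTimeWeight β M) t Λ κ aW sW NV ∧
      TowerVolumeDataTS (b * L) M β U μ (klFlowFrameU (b * L) M β U μ (nScales β + 1)) (nScales β) (imagTimeWeight β M) t Λ κ aW sW NV ∧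
        TowerCrossData L b M β μ (klFlowFrameU L M β U μ (nScales β + 1)) (klFlowFrameU (b * L) M β U μ (nScales β + 1)) (nScales β) (imagTimeWeight β M)
          Λ κ' aW' sW' eW' ΛT cW κf (fun j => sE j L) (fun j => cR j L) (fun j => cC j L) (fun j => δ j L)
  /-- (H6) the BASE: the keyed defect of the SOURCE-TRUNCATED RESCALED step-`0` states at the `2 r_L`-deep pins tends to zero uniformly in the instance -/
  h0 : ∀ (k : ℕ) (η : ℝ), 0 < η → ∀ᶠ L in atTop, ∀ (b M : ℕ) [NeZero L] [NeZero (b * L)] [NeZero M], Mth L b ≤ M →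
    ∀ (p : Fin k) (w : SrcLabel (b * L) M 0), (∀ i, 2 * r L ≤ (w.1.1.2 i).val % L ∧ (w.1.1.2 i).val % L + 2 * r L < L) →
      klKeyedDefectTS L b M β U μ (klFlowFrameU L M β U μ (nScales β + 1)) (klFlowFrameU (b * L) M β U μ (nScales β + 1)) t 0 k p w ≤ imagTimeWeight β M * η

/-- **The truncated package is the rescaled truncated package at `t = 1`** (the landed v10 chain is the special case). [folklore] -/
def TowerDataT.scaleOne {β U μ : ℝ} (D : TowerDataT β U μ) : TowerDataTS β U μ 1 where
  Mth := D.Mth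
  r := D.r
  hr := D.hr
  hRd := D.hRd
  Λ := D.Λ
  κ := D.κ
  aW := D.aW
  sW := D.sW
  κ' := D.κ'
  aW' := D.aW'
  sW' := D.sW'
  eW' := D.eW'
  ΛT := D.ΛT
  cW := D.cW
  κf := D.κf
  cRb := D.cRb
  cCb := D.cCb
  δb := D.δb
  ρ₀ := D.ρ₀
  ρf := D.ρf
  ρ₂ := D.ρ₂
  ρ' := D.ρ'
  ρ₃ := D.ρ₃
  ν₀ := D.ν₀
  ν₁ := D.ν₁
  ν₂ := D.ν₂
  ν₃ := D.ν₃
  ν₄ := D.ν₄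
  ν₅ := D.ν₅
  νE := D.νE
  ν₆ := D.ν₆
  ν₇ := D.ν₇
  ν₈ := D.ν₈
  NV := D.NV
  NS := D.NS
  sE := D.sE
  cR := D.cR
  cC := D.cC
  δ := D.δ
  hΛ := D.hΛ
  hΛmono := D.hΛmono
  hΛT := D.hΛT
  hκ := D.hκ
  haW := D.haW
  hρ := D.hρ
  hNV0 := D.hNV0
  hNSnn := D.hNSnn
  hNS0 := D.hNS0
  hNSsucc := D.hNSsucc
  hsm := D.hsm
  hmis := D.hmis
  hmis0 := D.hmis0
  hdata := by
    filter_upwards [D.hdata] with L hL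
    intro b M _ _ _ hM
    obtain ⟨h1, h2, h3⟩ := hL b M hM
    exact ⟨h1.scaleOne, h2.scaleOne, h3⟩
  h0 k η hη := by
    filter_upwards [D.h0 k η hη] with L hL
    intro b M _ _ _ hM p w hw
    rw [klKeyedDefectTS_one]
    exact hL b M hM p w hw

/-- `Nonempty (TowerDataT β U μ) → Nonempty (TowerDataTS β U μ 1)`. [folklore] -/
theorem nonempty_towerDataTS_one_of_towerDataT {β U μ : ℝ} (h : Nonempty (TowerDataT β U μ)) : Nonempty (TowerDataTS β U μ 1) :=
  h.map TowerDataT.scaleOne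

end Summit.HubbardSuperconductivity.HubbardSuperconductivity.Theorems.TwoVolumeSource

end
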